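import Summits.QuantumFields.YangMills.Theorems.F4SubCurvatureDoorSubCurvatureKernelGluedKernel
import Summits.QuantumFields.YangMills.Theorems.F4SubCurvatureDoorSubCurvatureKernelRepresentation
import HarnessLib

/-!
# Route `F4SubCurvatureDoor`, crux `SubCurvatureKernel` ⟨stmt-QuantumFields-23036⟩ — clause (K) COMPLETE for leg-scheme limit points:
# the REPRESENTATION CLAUSE of the crux (clause 6, verbatim) with a measurable, polynomially bounded kernel

Helper file (`--supports stmt-QuantumFields-23036 --as helper`; free-hands seat `ym-line-frs-p2` g17).  Definition-free, 0 sorry, standard axioms.  No item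
is closed; no summit, no crux and no mass gap is proved by this file.

WHAT.  ★ `repr_of_offDiagLimitAlong`: under `MomentBounds6 G r a` (positive unit map `a → 0`), along every admissible leg scheme and subsequence
`φ → ∞`, every off-diagonal limit point `S₁` has a measurable two-point kernel `K : ℝ⁴ → ℂ` with `‖K u‖ ≤ A (1 + ‖u‖⁻¹)⁸` such that FOR EVERY
off-diagonal test function `F` (all of `⁰𝒮₂`, supports touching the diagonal allowed): `K(x₀ − x₁) F(x)` is integrable and
`S₁ 2 F = ∫ K(x₀ − x₁) F(x) dx` — clause 6 of `SubCurvatureKernel` (route file :338ff) in its own letters (`subCurvatureKernel_rung_repr`, crux prefix,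
with the redundant `HasCompactSupport` binder of the clause kept).  Composition of ✓`exists_gluedKernel_of_offDiagLimitAlong` (one kernel for all
separations, from translation invariance ✓p733041, the explicit density constant ✓p735508, `L¹` extension ✓p734293, LEAD sfw-p2 g76's Rudin-6.16
density ✓p733793, fibre averaging ✓p734117) with the kernel-generic ✓`repr_of_isOffDiagonal` (flat vanishing absorbs the `‖u‖⁻⁸` singularity).

SOFT-HALF LEDGER after this file: (W) W(B₄)-invariance of `S₁` ✓px19 · (T) ✓ · (R) `RPPos` ✓p733252 · (F) King faithfulness ✓p733727 (needs `K`
continuous off `0`) · (K) ✓ THIS FILE (measurable `K`) · OPEN: (C) a version of `K` CONTINUOUS off `0` (then REAL-valued by reality of `S₁` on real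
test functions, W(B₄)-invariant by (W) + uniqueness, RP pointwise by (R), bounded off the unit ball by (K)'s bound) — and the crux's SUB-CURVATURE
clause `‖x‖⁸ K(x) → 0` (asymptotic freedom), untouched.

HONEST LABEL: helpers toward the SOFT half of an OPEN-PROBLEM crux; ⟨23036⟩ open; the Yang–Mills mass gap is NOT proved; no summit is proved by a line.
-/

set_option autoImplicit false

noncomputable section

open scoped SchwartzMap BigOperators
open MeasureTheory Filter Topology Set
open Literature.MathematicalPhysics.QuantumFieldTheory Literature.MathematicalPhysics.QuantumLattice
open Literature.MathematicalPhysics.AQFT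
open Summit.QuantumFields.YangMills.Cruxes.OSLegsFromFemtoAndGap.DlrCollarTransfer (MomentBounds6)
open Summit.QuantumFields.YangMills.Cruxes.OSLegsAtWeakCouplingC.Sketch (Separated)
open Summit.QuantumFields.YangMills.Theorems.ROT (IsLegScheme OffDiagLimitAlong)
open Summit.QuantumFields.YangMills.Theorems.NPointIsotropy.Negative (E4)
open Summit.QuantumFields.YangMills.Theorems.F4SubCurvatureDoorSubCurvatureKernelGlued (exists_gluedKernel_of_offDiagLimitAlong)
open Summit.QuantumFields.YangMills.Theorems.F4SubCurvatureDoorSubCurvatureKernelRepr (repr_of_isOffDiagonal)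

namespace Summit.QuantumFields.YangMills.Theorems.F4SubCurvatureDoorSubCurvatureKernelLegRepr

variable {G : Type} [Group G] [TopologicalSpace G] [IsTopologicalGroup G] [CompactSpace G]
  [MeasurableSpace G] [BorelSpace G]

/-- ★ **CLAUSE (K) FOR LEG-SCHEME LIMIT POINTS — the representation clause of `SubCurvatureKernel` verbatim, with a measurable polynomially bounded
kernel.** [cite: OS1973, §2] [cite: GlimmJaffe1987, §6.1] [cite: Rudin1987, Thm. 6.16] -/
theorem repr_of_offDiagLimitAlong (r : LatticeRep G) {a : ℝ → ℝ} (hapos : ∀ β, 0 < a β)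
    (ha0 : Tendsto a atTop (𝓝 0)) (hMB : MomentBounds6 G r a) {sch : SpeciesScheme (YMSpecies G)}
    (hsch : IsLegScheme a sch) {φ : ℕ → ℕ} (hφ : Tendsto φ atTop atTop) {S₁ : SchwingerFamily E4}
    (hS₁ : OffDiagLimitAlong r sch φ S₁) :
    ∃ K : E4 → ℂ, Measurable K ∧ (∃ A : ℝ, ∀ u, ‖K u‖ ≤ A * (1 + ‖u‖⁻¹) ^ 8) ∧
      ∀ F : 𝓢((Fin 2 → E4), ℂ), IsOffDiagonal F →
        Integrable (fun x : Fin 2 → E4 => K (x 0 - x 1) * F x) ∧ S₁ 2 F = ∫ x : Fin 2 → E4, K (x 0 - x 1) * F x := by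
  obtain ⟨K, hKm, ⟨A, hA⟩, hrep⟩ := exists_gluedKernel_of_offDiagLimitAlong r hapos ha0 hMB hsch hφ hS₁
  have hA0 : 0 ≤ A := by
    have h := hA 0
    have h1 : (0 : ℝ) ≤ ‖K 0‖ := norm_nonneg _
    have h2 : (1 + ‖(0 : E4)‖⁻¹) ^ 8 = 1 := by simp
    rw [h2, mul_one] at h
    linarith
  exact ⟨K, hKm, ⟨A, hA⟩, fun F hF => repr_of_isOffDiagonal (S₁ 2) K hKm hA0 hA hrep F hF⟩

/-- **Clause 6 of `SubCurvatureKernel` in the crux's quantifier prefix** (for every compact simple `G`, representation `r`, positive unit map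
`a → 0` with `MomentBounds6`, admissible leg scheme, subsequence, off-diagonal limit point `S₁`): a measurable kernel `K` (polynomially bounded at
the diagonal) with `Integrable (K(x₀ − x₁) F) ∧ S₁ 2 F = ∫ K(x₀ − x₁) F` for every off-diagonal compactly supported test function `F` — the
letter of clause 6; `K` is complex-valued and measurable here (continuity = clause (C), open). [cite: OS1973, §2] [cite: Rudin1987, Thm. 6.16] -/
theorem subCurvatureKernel_rung_repr :
    ∀ (G : Type) [Group G] [TopologicalSpace G] [IsTopologicalGroup G] [CompactSpace G], IsCompactSimpleLieGroup G →
      letI : MeasurableSpace G := borel G; haveI : BorelSpace G := ⟨rfl⟩;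
      ∀ (r : LatticeRep G) (a : ℝ → ℝ), (∀ β, 0 < a β) → Tendsto a atTop (nhds 0) → MomentBounds6 G r a →
        ∀ sch : SpeciesScheme (YMSpecies G), IsLegScheme a sch → ∀ φ : ℕ → ℕ, Tendsto φ atTop atTop →
          ∀ S₁ : SchwingerFamily E4, OffDiagLimitAlong r sch φ S₁ →
            ∃ K : E4 → ℂ, Measurable K ∧ (∃ A : ℝ, ∀ u, ‖K u‖ ≤ A * (1 + ‖u‖⁻¹) ^ 8) ∧
              ∀ F : 𝓢((Fin 2 → E4), ℂ), IsOffDiagonal F → HasCompactSupport (F : (Fin 2 → E4) → ℂ) →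
                Integrable (fun x : Fin 2 → E4 => K (x 0 - x 1) * F x) ∧
                  S₁ 2 F = ∫ x : Fin 2 → E4, K (x 0 - x 1) * F x := by
  intro G _ _ _ _ _
  letI : MeasurableSpace G := borel G
  haveI : BorelSpace G := ⟨rfl⟩
  intro r a hapos ha0 hMB sch hsch φ hφ S₁ hS₁
  obtain ⟨K, hKm, hKb, hK⟩ := repr_of_offDiagLimitAlong r hapos ha0 hMB hsch hφ hS₁
  exact ⟨K, hKm, hKb, fun F hF _ => hK F hF⟩

end Summit.QuantumFields.YangMills.Theorems.F4SubCurvatureDoorSubCurvatureKernelLegRepr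

end
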